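import Summits.HodgeConjecture.HodgeConjecture.Theorems.MarkmanPartnerTransportQInverseOfLefschetzStandard
import Summits.HodgeConjecture.HodgeConjecture.Theorems.MarkmanPartnerTransportKappaClassesOfQInverse
import Summits.HodgeConjecture.HodgeConjecture.Theorems.EndoscopicMiddleDegreeCupProductAlgebraic
import HarnessLib

/-!
# Route MarkmanPartnerTransport · support #3 `IsometrySpannedThird` BY NAME, at every Picard rank, from four
# published facts: Verbitsky–Guan (cohomology of `K3^{[2]}`-type), O'Grady (dual BBF class algebraic),
# Charles–Markman (`B(X)` for `K3^{[n]}`-type) and Markman 2024 (rational Hodge isometries are algebraic)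

Composition of the two halves landed separately:
* `qInvAlgebraic_of_lefschetzStandard` (`…QInverseOfLefschetzStandard`, W-QX2): the inverse Beauville–Bogomolov
  class `Q_X ∈ H⁴(X × X)` is algebraic, granted `B(X)`, `b₃ = 0` and the multiplicativity of algebraic classes;
* `isometrySpannedThird_of_qInvAlgebraic` (`…KappaClassesOfQInverse`, W-QX1): `Q_X` algebraic ⇒ the classes
  `κ_g = pr_{1*}(Q_X ∪ Z_g)` are algebraic (Markman's `Z_g`) ⇒ `IsometrySpannedThird` (via
  `isometrySpannedThird_of_kappaClasses`);
with the multiplicativity of algebraic classes (Voisin II Prop. 9.20, the tree's named fact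
`Voisin2003_cupProduct_algebraicClasses`) DISCHARGED by the tree theorem
`Theorems.Voisin2003_cupProduct_algebraicClasses_holds`. Result: the route item `IsometrySpannedThird`
(stmt-HodgeConjecture-19651) modulo exactly {`VerbitskyGuan_cohomology_K3HilbertSquareType`,
`OGrady2008_dualBBFClass_algebraic`, `CharlesMarkman2013_lefschetzStandard_K3HilbertType`,
`Markman2024_rationalHodgeIsometry_algebraic_marked`} — four named facts (published theorems), no partner surface,
no Picard-rank hypothesis. CONDITIONAL; credits nothing; nothing here says HC is proved. Cell hodge-nonav
(p1 g35 asks W-QX1/W-QX2; seats 20241-p1 g10 and 19716-p2 g2).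

References: F. Charles, E. Markman, Compos. Math. 149 (2013) Thm. 1.1; E. Markman, Compos. Math. 160 (2024)
Thm. 1.1; K. O'Grady (2008) §3; M. Verbitsky (1996) / D. Guan (2001); C. Voisin, *Hodge Theory II* Prop. 9.20.
-/

noncomputable section

set_option linter.dupNamespace false

open Literature.AlgebraicGeometry Literature.AlgebraicGeometry.HodgeTheory Literature.AlgebraicGeometry.Hyperkaehler

namespace Summit.HodgeConjecture.HodgeConjecture.Theorems.MarkmanPartnerTransport.PartnerLattice

/-- **F-QX by name: `QInvAlgebraic` holds granted `B(X)` for `K3^{[2]}`-type fourfolds (Charles–Markman) and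
`b₃ = 0` (Verbitsky–Guan)** — `qInvAlgebraic_of_lefschetzStandard` with the cup-product fact discharged by
`Theorems.Voisin2003_cupProduct_algebraicClasses_holds` (`qInvClass φ` is by definition the class `QInv[X, φ]`
of that file). [cite: CharlesMarkman2013, Thm. 1.1 (§1)] [cite: Kleiman1968AlgebraicCycles, §2] -/
theorem qInvAlgebraic_of_charlesMarkman (hV : VerbitskyGuan_cohomology_K3HilbertSquareType)
    (hB : CharlesMarkman2013_lefschetzStandard_K3HilbertType) : QInvAlgebraic :=
  qInvAlgebraic_of_lefschetzStandard hV Theorems.Voisin2003_cupProduct_algebraicClasses_holds hB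

/-- **Item #3 `IsometrySpannedThird` of route MarkmanPartnerTransport, BY NAME and at every Picard rank,
from the four named facts {Verbitsky–Guan, O'Grady, Charles–Markman, Markman 2024}** (module docstring).
CONDITIONAL on those facts; credits nothing; nothing here says HC is proved.
[cite: Markman2024, Thm. 1.1 (§1.1)] [cite: CharlesMarkman2013, Thm. 1.1 (§1)]
[cite: OGrady2008NumericalK3Square, §3 proof of Prop. 3.2] -/
theorem isometrySpannedThird_of_lefschetzStandard_of_markman
    (hV : VerbitskyGuan_cohomology_K3HilbertSquareType) (hO : OGrady2008_dualBBFClass_algebraic)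
    (hB : CharlesMarkman2013_lefschetzStandard_K3HilbertType)
    (hMk : Markman2024_rationalHodgeIsometry_algebraic_marked) :
    Summit.HodgeConjecture.HodgeConjecture.Theses.MarkmanPartnerTransport.IsometrySpannedThird :=
  isometrySpannedThird_of_qInvAlgebraic hV hO Theorems.Voisin2003_cupProduct_algebraicClasses_holds hMk
    (qInvAlgebraic_of_charlesMarkman hV hB)

end Summit.HodgeConjecture.HodgeConjecture.Theorems.MarkmanPartnerTransport.PartnerLattice


/-! ## Appended (same seat, same day): O'Grady's algebraicity clause `q^∨ ∈ A²(X)` FOLLOWS from `B(X)`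

The consumers of `OGrady2008_dualBBFClass_algebraic` in this route use only its first clause (`q^∨` algebraic,
via `OGrady2008_dualBBFClass_algebraic.exists_cup_cup_eq`). That clause is IMPLIED by Charles–Markman's `B(X)`
(+ `b₃ = 0`): `q^∨ = dualBBFClass 2 φ = Δ^* Q_X` is the pull-back of the inverse Beauville–Bogomolov class along
the diagonal, `Q_X` is algebraic (`qInvAlgebraic_of_charlesMarkman`) and `Δ^*` preserves algebraic classes
(`Theorems.fulton1998_map_mem_algebraicClasses_holds`). Recorded for the planner: re-threading
`…IsometrySpannedThirdOfGraphClasses` on the weak clause would cut item #3's fact list to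
{Verbitsky–Guan, Charles–Markman, Markman 2024}. Nothing here says HC is proved.
-/

namespace Summit.HodgeConjecture.HodgeConjecture.Theorems.MarkmanPartnerTransport.PartnerLattice

open CategoryTheory MonoidalCategory CartesianMonoidalCategory Literature.AlgebraicTopology.SingularHomology
  Literature.AlgebraicGeometry.Motives

variable {X : SchemeOver ℂ}

/-- **`q^∨ = Δ^* Q_X`**: O'Grady's dual Beauville–Bogomolov class is the pull-back along the diagonal
`Δ = (𝟙, 𝟙) : X ⟶ X ⊗ X` of the inverse Beauville–Bogomolov class (`αᵢ ∪ αⱼ = Δ^*(pr₁^*αᵢ ∪ pr₂^*αⱼ)`,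
`cupProduct_eq_map_diagonal`; the coefficients agree: `(Λ₂ ⊗ ℚ)⁻¹ ↦ (Λ₂ ⊗ ℂ)⁻¹`, `k3HilbertGramInv_two_mul_complex`).
[cite: OGrady2008NumericalK3Square, §3 (definition of q^∨)] [cite: VoisinHodgeII2003, proof of Prop. 9.20 (second display)] -/
theorem dualBBFClass_eq_map_diagonal_qInvClass (φ : complexBetti X 2 ≃ₗ[ℂ] (K3HilbertIndex → ℂ)) :
    dualBBFClass 2 φ = complexBetti.map (lift (𝟙 X) (𝟙 X)) (2 * 2) (qInvClass φ) := by
  have hinv : ((k3HilbertGram 2).map (Int.cast : ℤ → ℂ))⁻¹ = (k3HilbertGramInv 2).map (Rat.cast : ℚ → ℂ) :=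
    Matrix.inv_eq_left_inv k3HilbertGramInv_two_mul_complex
  rw [dualBBFClass_def, qInvClass]
  simp only [map_sum, map_smul, hinv, Matrix.map_apply]
  refine Finset.sum_congr rfl fun i _ ↦ Finset.sum_congr rfl fun j _ ↦ ?_
  rw [cupProduct_eq_map_diagonal]

/-- **O'Grady's algebraicity clause from `B(X)`: `q^∨ = dualBBFClass 2 φ ∈ A²(X)` for every marked smooth
projective `K3^{[2]}`-type fourfold, granted `B(X)` (Charles–Markman) and `b₃ = 0` (Verbitsky–Guan)** —
`q^∨ = Δ^* Q_X`, `Q_X` algebraic (`qInvAlgebraic_of_charlesMarkman`), `Δ^*` preserves algebraic classes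
(`Theorems.fulton1998_map_mem_algebraicClasses_holds`). The integrality clause `(2/5)q^∨ ∈ H⁴(X;ℤ)` of the fact
is NOT touched. CONDITIONAL; credits nothing. [cite: CharlesMarkman2013, Thm. 1.1 (§1)]
[cite: OGrady2008NumericalK3Square, §3 proof of Prop. 3.2 item (6)] -/
theorem dualBBFClass_mem_algebraicClasses_of_lefschetzStandard
    (hV : VerbitskyGuan_cohomology_K3HilbertSquareType) (hB : CharlesMarkman2013_lefschetzStandard_K3HilbertType)
    (hX : IsSmoothProjective 4 X) (hK : IsOfK3HilbertSquareType X)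
    {φ : complexBetti X 2 ≃ₗ[ℂ] (K3HilbertIndex → ℂ)} {P : complexBetti X (2 * 4)} {z : K3HilbertIndex → ℂ}
    (hM : ((IsIntegralClass P ∧ ∀ Q : complexBetti X (2 * 4), IsIntegralClass Q → ∃ n : ℤ, Q = n • P) ∧
      (∀ c : complexBetti X 2, IsIntegralClass c ↔ ∃ v : K3HilbertIndex → ℤ, φ c = fun i => (v i : ℂ)) ∧
      (∀ a : complexBetti X 2, cupPowTwo a 4 = ((3 : ℂ) * (k3HilbertForm 2 (φ a) (φ a)) ^ 2) • P) ∧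
      (IsOfHodgeType 4 X 2 2 0 (LinearEquiv.symm φ z) ∧
        ∀ τ : complexBetti X 2, IsOfHodgeType 4 X 2 2 0 τ → ∃ t : ℂ, τ = t • LinearEquiv.symm φ z) ∧
      (∀ c : complexBetti X 2, IsOfHodgeType 4 X 2 1 1 c ↔
        (k3HilbertForm 2 (φ c) z = 0 ∧ k3HilbertForm 2 (φ c) (star z) = 0)) ∧
      (k3HilbertForm 2 z z = 0 ∧ 0 < (k3HilbertForm 2 (star z) z).re))) :
    dualBBFClass 2 φ ∈ algebraicClasses X 2 := by
  rw [dualBBFClass_eq_map_diagonal_qInvClass]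
  exact Theorems.fulton1998_map_mem_algebraicClasses_holds (lift (𝟙 X) (𝟙 X))
    (IsSmoothProjective.tensor_holds hX hX) hX 2 _ (qInvAlgebraic_of_charlesMarkman hV hB X hX hK φ P z hM)

end Summit.HodgeConjecture.HodgeConjecture.Theorems.MarkmanPartnerTransport.PartnerLattice

end
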